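import Literature.Geometry.Lorentzian.KerrHyperboloidalFlux
import HarnessLib

/-!
# Two-sided comparison of the Kerr–Schild energy flux with the coordinate energy
(family `gr`, infrastructure for the linear-wave statements **gr.S24**; trunk G08 = T-LORENTZ;
namespace `Literature.Lorentz.Kerr`)

`KerrHyperboloidalFlux.lean` proves the *coercivity* half of the comparability between the energy
density of the Kerr–Schild time vector `V = −g♯(dt*)` (`Kerr.timeVector`, `g(V, V) = −1 − 2H`) and
the coordinate gradient: `∑_μ (∂_μ ψ)² ≤ 4 T[ψ](V, V)` on the whole chart `{r > 0}`
(`Kerr.sum_sq_mvfderiv_le_four_mul_stressEnergy`), and uses it to reduce the coordinate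
local-energy decay of `BlackHoles.lean` to DRSR's Cor. 3.1 in flux form. This file supplies the
other half and the integrated statements:

* `Kerr.two_mul_stressEnergy_timeVector`: the energy density in Kerr–Schild components,
  `2 T[ψ](V, V) = ((1 + 2H) u − 2H q)² + q² + (1 + 2H)(|ξ⃗|² − q²)` with `u = ∂₀ψ`,
  `ξ⃗ = (∂₁ψ, ∂₂ψ, ∂₃ψ)`, `q = ℓ⃗ · ξ⃗` (and `Kerr.gradSq_smoothMetric`:
  `g⁻¹(dψ, dψ) = −u² + |ξ⃗|² − 2H (dψ(ℓ♯))²`);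
* `Kerr.stressEnergy_timeVector_le_sum_sq` (**upper bound**): for `M ≥ 0`,
  `T[ψ](V, V) ≤ (2 + 5H + 8H²) ∑_μ (∂_μ ψ)²` on the chart; `Kerr.scalarH_le_one`: `H ≤ 1` on the
  subextremal exterior, whence the absolute constant `15` there
  (`Kerr.stressEnergy_timeVector_le_sum_sq_of_isSubextremal`) and, with the coercivity of
  `KerrHyperboloidalFlux.lean`, the two-sided pointwise comparison in the currency of
  `WeightedNorms.lean`: `¼ · coordEnergyDensity ≤ T(V, V) ≤ 15 · coordEnergyDensity`
  (`Kerr.coordEnergyDensity_comparison_of_isSubextremal`);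
* integrated forms: `Kerr.localLeafFlux` (the flux `∫_{Σ̃_τ(h) ∩ {‖y‖ ≤ R}} J^V_μ n^μ` through the
  part of a graph leaf over a coordinate ball — the quantity of the *local* estimates of DRSR's
  Cor. 3.1 — companion of `Kerr.leafFlux`), the identification of the height-`0` leaves with the
  Kerr–Schild slices (`Kerr.leafFluxDensity_zero_height_of_mem`), and the comparisons
  `sliceEnergy ≤ 4 · leafFlux 0`, `leafFlux 0 ≤ 15 · sliceEnergy`,
  `localSliceEnergy R ≤ 4 · localLeafFlux h R`, `localLeafFlux h R ≤ 15 · localSliceEnergy R` for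
  `h = 0` and for the cut-off graph heights `h = cutoffHeight σ a R₁`, `R < R₁`, of
  `KerrHyperboloidalFlux.lean` — in particular `h_{R₁} = hypHeight` (leaves reaching `i⁰`) and
  `h♯_{R₁} = scriHeight` (leaves terminating at `𝓘⁺`) — since on `{‖y‖ ≤ R}` those leaves *are*
  the Kerr–Schild slices with normal `V`.

This is the standard comparability `∫_{Σ_τ} J^N_μ n^μ ∼ ∫ (|∂_{t*}ψ|² + |∂_rψ|² + |∇̸ψ|²)`, "with
constants `c`, `C` not depending on `ψ`", of Dafermos–Rodnianski–Shlapentokh-Rothman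
(arXiv:1402.7034, §3.1, the display following (23)), for the Kerr–Schild foliation and the
multiplier `N = V` (admissible for Thm. 3.1 by the footnote to §3.1: `φ_τ`-invariant, strictly
timelike, asymptotic to `T`), made quantitative with explicit constants; the objects `T`, `J^V` are
those of Dafermos–Rodnianski, arXiv:0811.0354, §13 = App. D (`EnergyCurrents.lean`). The upper
bound is what converts the right-hand sides `C ∫_{Σ₀} J^N_μ n^μ` of DRSR's Thm. 3.1/3.2 into the
coordinate (Sobolev) energies of the data used by the consequence-form facts of `BlackHoles.lean`,
`KerrWaveDecay.lean`, `KerrWaveEnergy.lean`.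

## The computation

With `h = H ≥ 0`, `|ℓ⃗| = 1` (`Kerr.sum_sq_nullCovectorFun`), `u`, `ξ⃗`, `q` as above:
`2T = ((1+2h)u − 2hq)² + q² + (1+2h)(|ξ⃗|² − q²)`, `0 ≤ |ξ⃗|² − q² ≤ |ξ⃗|²` (Lagrange), and
`((1+2h)u − 2hq)² ≤ 2(1+2h)²u² + 8h²q²`, so `2T ≤ 2(1+2h)²u² + (1 + 2h + 8h²)|ξ⃗|² ≤
(4 + 10h + 16h²)(u² + |ξ⃗|²)`.

## References

* M. Dafermos, I. Rodnianski, Y. Shlapentokh-Rothman, *Decay for solutions of the wave equation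
  on Kerr exterior spacetimes III*, Ann. of Math. 183 (2016), arXiv:1402.7034, §3.1 (Thm. 3.1, the
  footnote on `N`, and the comparability display following (23)), §3.3 (Cor. 3.1, local fluxes
  through `Σ̃_τ ∩ {r ≤ R}`) (key `DafermosRodnianskiShlapentokhrothman2014`).
* M. Dafermos, I. Rodnianski, *Lectures on black holes and linear waves*, arXiv:0811.0354, §13
  (= App. D), §5.1 (key `DafermosRodnianski2008`).
* R. P. Kerr, A. Schild (1965); M. Visser, arXiv:0706.0622, (32)–(35) (key `KerrSchild1965`).
-/

noncomputable section

open Bundle Set TopologicalSpace Filter MeasureTheory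
open scoped Manifold ContDiff Topology ENNReal

namespace Literature.Geometry.Lorentzian

namespace Kerr

/-! ### `H ≤ 1` on the subextremal exterior -/

/-- `H ≤ 1` on the subextremal exterior: `H = M r³/(r⁴ + a² z²) ≤ M / r < M / r₊ ≤ 1` since
`r₊ = M + √(M² − a²) ≥ M > 0` (Visser arXiv:0706.0622, (33); DRSR arXiv:1402.7034, §2.2).
[folklore] -/
theorem scalarH_le_one {M a : ℝ} (hMa : IsSubextremal M a) {x : E4}
    (hx : x ∈ region a (rPlus M a)) : scalarH M a x ≤ 1 := by
  have hM : 0 < M := hMa.pos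
  have hr : rPlus M a < radius a x := (le_max_left _ _).trans_lt hx
  have hrp : M ≤ rPlus M a := by
    have := Real.sqrt_nonneg (M ^ 2 - a ^ 2)
    simp only [rPlus]; linarith
  have hr0 : 0 < radius a x := hM.trans_le (hrp.trans hr.le)
  unfold scalarH
  rw [div_le_one (by positivity)]
  nlinarith [sq_nonneg (a * x 3), pow_pos hr0 3, hrp.trans hr.le]

/-! ### The differential in Kerr–Schild components -/

/-- `dψ(ℓ♯) = −∂₀ψ + ℓ₁ ∂₁ψ + ℓ₂ ∂₂ψ + ℓ₃ ∂₃ψ` for `ℓ♯ = (−1, ℓ⃗)` (Kerr–Schild 1965).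
[cite: KerrSchild1965] -/
theorem dcov_apply_nullVector {a r₀ : ℝ} (ψ : region a r₀ → ℝ) (x : region a r₀) :
    dcov ψ x (nullVector a x.1) = -dcov ψ x (E4.basisVector 0) +
      (nullCovectorFun a x.1 1 * dcov ψ x (E4.basisVector 1) +
        nullCovectorFun a x.1 2 * dcov ψ x (E4.basisVector 2) +
        nullCovectorFun a x.1 3 * dcov ψ x (E4.basisVector 3)) := by
  rw [E4.linearMap_apply_eq_sum, Fin.sum_univ_four]
  simp only [nullVector_apply_zero, nullVector_apply_one, nullVector_apply_two,
    nullVector_apply_three]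
  ring

/-- `dψ(V) = ∂₀ψ − 2H dψ(ℓ♯)` for `V = Kerr.timeVector = ∂_{t*} − 2H ℓ♯` (Dafermos–Rodnianski
arXiv:0811.0354, §5.1). [cite: DafermosRodnianski2008, §5.1] -/
theorem dcov_apply_timeVector {M a r₀ : ℝ} (ψ : region a r₀ → ℝ) (x : region a r₀) :
    dcov ψ x (timeVector M a x.1) =
      dcov ψ x (E4.basisVector 0) - 2 * scalarH M a x.1 * dcov ψ x (nullVector a x.1) := by
  simp only [timeVector, map_sub, map_smul, smul_eq_mul]

variable [Facts]

/-! ### The gradient square and the energy density of `V` in Kerr–Schild components -/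

/-- **The gradient square of the Kerr metric in Kerr–Schild components**:
`g⁻¹(dψ, dψ) = −(∂₀ψ)² + ∑ᵢ (∂ᵢψ)² − 2H (dψ(ℓ♯))²` (`g^{μν} = η^{μν} − 2H ℓ^μ ℓ^ν`,
`Kerr.sharp_smoothMetric`; Kerr–Schild 1965; Dafermos–Rodnianski arXiv:0811.0354, §13 = App. D
for `∂^αψ ∂_αψ`). [cite: DafermosRodnianski2008, §13 (App. D) p. 56] -/
theorem gradSq_smoothMetric (M a r₀ : ℝ) (ψ : region a r₀ → ℝ) (x : region a r₀) :
    (smoothMetric M a r₀).gradSq ψ x =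
      -dcov ψ x (E4.basisVector 0) ^ 2 +
        (dcov ψ x (E4.basisVector 1) ^ 2 + dcov ψ x (E4.basisVector 2) ^ 2 +
          dcov ψ x (E4.basisVector 3) ^ 2) -
        2 * scalarH M a x.1 * dcov ψ x (nullVector a x.1) ^ 2 := by
  rw [PseudoRiemannianMetric.gradSq, PseudoRiemannianMetric.innerDual, sharp_smoothMetric]
  change dcov ψ x (coSharp M a x.1 (dcov ψ x)) = _
  simp only [coSharp, map_sub, map_smul, smul_eq_mul, apply_etaSharp]
  ring

/-- **The energy density `T[ψ](V, V)` in Kerr–Schild components.** With `u = ∂₀ψ`,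
`ξ⃗ = (∂₁ψ, ∂₂ψ, ∂₃ψ)`, `q = ℓ⃗ · ξ⃗` and `h = H`:
`2 T[ψ](V, V) = ((1 + 2h) u − 2h q)² + q² + (1 + 2h)(|ξ⃗|² − q²)`
(from `T(V,V) = (Vψ)² − ½ g(V,V) g⁻¹(dψ,dψ)`, `g(V, V) = −1 − 2H`, `gradSq_smoothMetric`; a
polynomial identity). Dafermos–Rodnianski arXiv:0811.0354, §13 (App. D), p. 56 (`T`, `J^V`);
§5.1 (the chart). [cite: DafermosRodnianski2008, §13 (App. D) p. 56] -/
theorem two_mul_stressEnergy_timeVector (M a r₀ : ℝ) (ψ : region a r₀ → ℝ) (x : region a r₀) :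
    2 * (smoothMetric M a r₀).stressEnergy ψ x (timeVector M a x.1) (timeVector M a x.1) =
      ((1 + 2 * scalarH M a x.1) * dcov ψ x (E4.basisVector 0) -
          2 * scalarH M a x.1 *
            (nullCovectorFun a x.1 1 * dcov ψ x (E4.basisVector 1) +
              nullCovectorFun a x.1 2 * dcov ψ x (E4.basisVector 2) +
              nullCovectorFun a x.1 3 * dcov ψ x (E4.basisVector 3))) ^ 2 +
        (nullCovectorFun a x.1 1 * dcov ψ x (E4.basisVector 1) +
            nullCovectorFun a x.1 2 * dcov ψ x (E4.basisVector 2) +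
            nullCovectorFun a x.1 3 * dcov ψ x (E4.basisVector 3)) ^ 2 +
        (1 + 2 * scalarH M a x.1) *
          (dcov ψ x (E4.basisVector 1) ^ 2 + dcov ψ x (E4.basisVector 2) ^ 2 +
              dcov ψ x (E4.basisVector 3) ^ 2 -
            (nullCovectorFun a x.1 1 * dcov ψ x (E4.basisVector 1) +
                nullCovectorFun a x.1 2 * dcov ψ x (E4.basisVector 2) +
                nullCovectorFun a x.1 3 * dcov ψ x (E4.basisVector 3)) ^ 2) := by
  have hx : 0 < radius a x.1 := radius_pos_of_mem_region x.2
  have hVV : (smoothMetric M a r₀).val x (timeVector M a x.1) (timeVector M a x.1) =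
      -1 - 2 * scalarH M a x.1 := by
    rw [smoothMetric_val]
    exact bilin_timeVector_timeVector hx
  rw [PseudoRiemannianMetric.stressEnergy_apply]
  simp only [mvfderiv_apply_eq_dcov]
  rw [dcov_apply_timeVector, gradSq_smoothMetric, hVV, dcov_apply_nullVector]
  ring

/-! ### The upper bound and the two-sided pointwise comparison -/

/-- **Upper bound for the energy density of the Kerr–Schild time vector**: for `M ≥ 0`,
`T[ψ](V, V) ≤ (2 + 5H + 8H²) ∑_μ (∂_μ ψ)²` at every point of the chart `{r > 0}` (module
docstring, *The computation*). The upper half of the comparability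
`∫_Σ J^N_μ n^μ ∼ ∫ |∂_{t*}ψ|² + |∂_rψ|² + |∇̸ψ|²` of DRSR, arXiv:1402.7034, §3.1 (display following
(23)); the lower half is `Kerr.sum_sq_mvfderiv_le_four_mul_stressEnergy`.
[cite: DafermosRodnianskiShlapentokhrothman2014, §3.1 display following (23)] -/
theorem stressEnergy_timeVector_le_sum_sq {M : ℝ} (hM : 0 ≤ M) (a r₀ : ℝ)
    (ψ : region a r₀ → ℝ) (x : region a r₀) :
    (smoothMetric M a r₀).stressEnergy ψ x (timeVector M a x.1) (timeVector M a x.1) ≤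
      (2 + 5 * scalarH M a x.1 + 8 * scalarH M a x.1 ^ 2) *
        ∑ μ : Fin 4, (mvfderiv 𝓘(ℝ, E4) ψ x (E4.basisVector μ)) ^ 2 := by
  have hx : 0 < radius a x.1 := radius_pos_of_mem_region x.2
  have h2T := two_mul_stressEnergy_timeVector M a r₀ ψ x
  simp only [mvfderiv_apply_eq_dcov, Fin.sum_univ_four]
  set T := (smoothMetric M a r₀).stressEnergy ψ x (timeVector M a x.1) (timeVector M a x.1)
  set h := scalarH M a x.1
  set u := dcov ψ x (E4.basisVector 0)
  set p₁ := dcov ψ x (E4.basisVector 1)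
  set p₂ := dcov ψ x (E4.basisVector 2)
  set p₃ := dcov ψ x (E4.basisVector 3)
  set l₁ := nullCovectorFun a x.1 1
  set l₂ := nullCovectorFun a x.1 2
  set l₃ := nullCovectorFun a x.1 3
  have h0 : 0 ≤ h := scalarH_nonneg hM a x.1
  have hnull : l₁ ^ 2 + l₂ ^ 2 + l₃ ^ 2 = 1 := sum_sq_nullCovectorFun hx
  set q := l₁ * p₁ + l₂ * p₂ + l₃ * p₃ with hq
  have hS : 0 ≤ p₁ ^ 2 + p₂ ^ 2 + p₃ ^ 2 - q ^ 2 := by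
    nlinarith [sq_nonneg (l₁ * p₂ - l₂ * p₁), sq_nonneg (l₁ * p₃ - l₃ * p₁),
      sq_nonneg (l₂ * p₃ - l₃ * p₂)]
  have hA : ((1 + 2 * h) * u - 2 * h * q) ^ 2 ≤
      2 * (1 + 2 * h) ^ 2 * u ^ 2 + 8 * h ^ 2 * q ^ 2 := by
    nlinarith [sq_nonneg ((1 + 2 * h) * u + 2 * h * q)]
  nlinarith [hS, hA, h0, mul_nonneg h0 hS, mul_nonneg (mul_nonneg h0 h0) hS, h2T,
    sq_nonneg u, sq_nonneg q, mul_nonneg h0 (sq_nonneg u), mul_nonneg h0 (sq_nonneg q),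
    mul_nonneg (mul_nonneg h0 h0) (sq_nonneg u)]

/-- On the **subextremal exterior** `{r > r₊}` (`|a| < M`) the upper constant is absolute:
`T[ψ](V, V) ≤ 15 ∑_μ (∂_μ ψ)²` (`0 ≤ H ≤ 1` there, `Kerr.scalarH_le_one`). DRSR, arXiv:1402.7034,
§3.1 (display following (23): constants "not depending on `ψ`").
[cite: DafermosRodnianskiShlapentokhrothman2014, §3.1 display following (23)] -/
theorem stressEnergy_timeVector_le_sum_sq_of_isSubextremal {M a : ℝ} (hMa : IsSubextremal M a)
    (ψ : region a (rPlus M a) → ℝ) (x : region a (rPlus M a)) :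
    (smoothMetric M a (rPlus M a)).stressEnergy ψ x (timeVector M a x.1) (timeVector M a x.1) ≤
      15 * ∑ μ : Fin 4, (mvfderiv 𝓘(ℝ, E4) ψ x (E4.basisVector μ)) ^ 2 := by
  have h := stressEnergy_timeVector_le_sum_sq hMa.pos.le a (rPlus M a) ψ x
  have hH0 : 0 ≤ scalarH M a x.1 := scalarH_nonneg hMa.pos.le a x.1
  have hH1 : scalarH M a x.1 ≤ 1 := scalarH_le_one hMa x.2
  have hsum : 0 ≤ ∑ μ : Fin 4, (mvfderiv 𝓘(ℝ, E4) ψ x (E4.basisVector μ)) ^ 2 :=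
    Finset.sum_nonneg fun _ _ ↦ sq_nonneg _
  calc _ ≤ _ := h
    _ ≤ 15 * ∑ μ : Fin 4, (mvfderiv 𝓘(ℝ, E4) ψ x (E4.basisVector μ)) ^ 2 := by
        apply mul_le_mul_of_nonneg_right _ hsum
        nlinarith

/-- **The coordinate energy density dominates the `V`-energy density**: for `M ≥ 0`,
`T[ψ](V, V) ≤ (2 + 5H + 8H²) · coordEnergyDensity ψ x` on the chart (`coordEnergyDensity` of
`WeightedNorms.lean` equals `∑_μ (dψ(∂_μ))²`, `Kerr.coordEnergyDensity_eq_sum_sq_mvfderiv`).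
DRSR, arXiv:1402.7034, §3.1 (display following (23)).
[cite: DafermosRodnianskiShlapentokhrothman2014, §3.1 display following (23)] -/
theorem stressEnergy_timeVector_le_coordEnergyDensity {M : ℝ} (hM : 0 ≤ M) (a r₀ : ℝ)
    (ψ : region a r₀ → ℝ) (x : region a r₀) :
    (smoothMetric M a r₀).stressEnergy ψ x (timeVector M a x.1) (timeVector M a x.1) ≤
      (2 + 5 * scalarH M a x.1 + 8 * scalarH M a x.1 ^ 2) * coordEnergyDensity (region a r₀) ψ x.1 := by
  rw [coordEnergyDensity_eq_sum_sq_mvfderiv]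
  exact stressEnergy_timeVector_le_sum_sq hM a r₀ ψ x

/-- **Two-sided pointwise comparison on the subextremal exterior** with absolute constants:
`¼ · coordEnergyDensity ψ x ≤ T[ψ](V, V) ≤ 15 · coordEnergyDensity ψ x` on `{r > r₊}`, `|a| < M`
(lower half from `Kerr.coordEnergyDensity_le_four_mul_stressEnergy`). DRSR, arXiv:1402.7034,
§3.1 (display following (23)). [cite: DafermosRodnianskiShlapentokhrothman2014, §3.1 display following (23)] -/
theorem coordEnergyDensity_comparison_of_isSubextremal {M a : ℝ} (hMa : IsSubextremal M a)
    (ψ : region a (rPlus M a) → ℝ) (x : region a (rPlus M a)) :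
    (1 / 4 : ℝ) * coordEnergyDensity (region a (rPlus M a)) ψ x.1 ≤
        (smoothMetric M a (rPlus M a)).stressEnergy ψ x (timeVector M a x.1) (timeVector M a x.1) ∧
      (smoothMetric M a (rPlus M a)).stressEnergy ψ x (timeVector M a x.1) (timeVector M a x.1) ≤
        15 * coordEnergyDensity (region a (rPlus M a)) ψ x.1 := by
  refine ⟨?_, ?_⟩
  · have h := coordEnergyDensity_le_four_mul_stressEnergy hMa.pos.le ψ x
    linarith
  · have h := stressEnergy_timeVector_le_sum_sq_of_isSubextremal hMa ψ x
    rwa [coordEnergyDensity_eq_sum_sq_mvfderiv]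

/-! ### Height-`0` leaves are the Kerr–Schild slices; local leaf fluxes -/

/-- For the height function `h = 0` the leaf `Σ̃_τ(0)` is the Kerr–Schild slice `{t* = τ}` with
normal `V`, so its flux density over `y` is `T[ψ](V, V)(τ, y)` (DRSR arXiv:1402.7034, §2.2.5,
§3.1: the fluxes `∫_{Σ_τ} J^N_μ n^μ`). [folklore] -/
theorem leafFluxDensity_zero_height_of_mem {M a : ℝ} (ψ : region a (rPlus M a) → ℝ) (τ : ℝ)
    {y : E3} (hmem : E4.ofTimeSpace τ y ∈ region a (rPlus M a)) :
    leafFluxDensity M a 0 ψ τ y =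
      ENNReal.ofReal ((smoothMetric M a (rPlus M a)).stressEnergy ψ ⟨E4.ofTimeSpace τ y, hmem⟩
        (timeVector M a (E4.ofTimeSpace τ y)) (timeVector M a (E4.ofTimeSpace τ y))) := by
  have hpt : leafPoint (0 : E3 → ℝ) τ y = E4.ofTimeSpace τ y := leafPoint_of_eq_zero rfl τ
  have hmem' : leafPoint (0 : E3 → ℝ) τ y ∈ region a (rPlus M a) := hpt ▸ hmem
  rw [leafFluxDensity_of_mem _ _ _ hmem']
  have hN : leafNormal M a (0 : E3 → ℝ) ⟨leafPoint (0 : E3 → ℝ) τ y, hmem'⟩ =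
      timeVector M a (leafPoint (0 : E3 → ℝ) τ y) :=
    leafNormal_eq_timeVector _ (by simp)
  rw [hN]
  congr 1
  have : (⟨leafPoint (0 : E3 → ℝ) τ y, hmem'⟩ : region a (rPlus M a)) =
      ⟨E4.ofTimeSpace τ y, hmem⟩ := Subtype.ext hpt
  rw [this, hpt]

/-- Off the exterior the height-`0` flux density vanishes. [folklore] -/
theorem leafFluxDensity_zero_height_of_not_mem {M a : ℝ} (ψ : region a (rPlus M a) → ℝ) (τ : ℝ)
    {y : E3} (hmem : E4.ofTimeSpace τ y ∉ region a (rPlus M a)) :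
    leafFluxDensity M a 0 ψ τ y = 0 := by
  have hpt : leafPoint (0 : E3 → ℝ) τ y = E4.ofTimeSpace τ y := leafPoint_of_eq_zero rfl τ
  exact leafFluxDensity_of_not_mem _ _ _ (hpt ▸ hmem)

/-- The **local flux** `∫_{Σ̃_τ(h) ∩ {‖y‖ ≤ R}} J^V_μ[ψ] n^μ dσ = ∫_{‖y‖ ≤ R} T[ψ](V, W)(τ + h y, y) dy`
through the part of the leaf `Σ̃_τ(h)` over the closed coordinate ball of radius `R` (companion
of `Kerr.leafFlux`; the quantity of the local estimates `∫_{Σ̃_τ ∩ {r ≤ R}} J^N_μ n^μ` of DRSR,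
arXiv:1402.7034, §3.3, Cor. 3.1, and of `localSliceEnergy` of `WeightedNorms.lean`).
[cite: DafermosRodnianskiShlapentokhrothman2014, §3.3 Cor. 3.1] -/
def localLeafFlux (M a : ℝ) (h : E3 → ℝ) (ψ : region a (rPlus M a) → ℝ) (τ R : ℝ) : ℝ≥0∞ :=
  ∫⁻ y in Metric.closedBall (0 : E3) R, leafFluxDensity M a h ψ τ y

/-- The local flux is at most the total flux through the leaf. [folklore] -/
theorem localLeafFlux_le_leafFlux (M a : ℝ) (h : E3 → ℝ) (ψ : region a (rPlus M a) → ℝ)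
    (τ R : ℝ) : localLeafFlux M a h ψ τ R ≤ leafFlux M a h ψ τ :=
  setLIntegral_le_lintegral _ _

/-- The local flux is monotone in the radius. [folklore] -/
theorem localLeafFlux_mono (M a : ℝ) (h : E3 → ℝ) (ψ : region a (rPlus M a) → ℝ) (τ : ℝ)
    {R R' : ℝ} (hRR' : R ≤ R') : localLeafFlux M a h ψ τ R ≤ localLeafFlux M a h ψ τ R' :=
  lintegral_mono_set (Metric.closedBall_subset_closedBall hRR')

/-! ### Integrated comparisons: Kerr–Schild slices -/

/-- Pointwise comparison of the integrands on a Kerr–Schild slice (`M ≥ 0`): the cut-off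
coordinate energy density is at most `4×` the height-`0` flux density. [folklore] -/
theorem indicator_coordEnergyDensity_le_four_mul_leafFluxDensity {M a : ℝ} (hM : 0 ≤ M)
    (ψ : region a (rPlus M a) → ℝ) (τ : ℝ) (y : E3) :
    Set.indicator {y : E3 | E4.ofTimeSpace τ y ∈ region a (rPlus M a)}
        (fun y ↦ ENNReal.ofReal (coordEnergyDensity (region a (rPlus M a)) ψ (E4.ofTimeSpace τ y))) y ≤
      4 * leafFluxDensity M a 0 ψ τ y := by
  by_cases hmem : E4.ofTimeSpace τ y ∈ region a (rPlus M a)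
  · rw [Set.indicator_of_mem (show y ∈ {y : E3 | E4.ofTimeSpace τ y ∈ region a (rPlus M a)}
      from hmem), leafFluxDensity_zero_height_of_mem ψ τ hmem]
    have h2 := coordEnergyDensity_le_four_mul_stressEnergy hM ψ ⟨E4.ofTimeSpace τ y, hmem⟩
    calc ENNReal.ofReal (coordEnergyDensity (region a (rPlus M a)) ψ (E4.ofTimeSpace τ y))
        ≤ ENNReal.ofReal (4 * (smoothMetric M a (rPlus M a)).stressEnergy ψ
            ⟨E4.ofTimeSpace τ y, hmem⟩ (timeVector M a (E4.ofTimeSpace τ y))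
            (timeVector M a (E4.ofTimeSpace τ y))) := ENNReal.ofReal_le_ofReal h2
      _ = 4 * ENNReal.ofReal ((smoothMetric M a (rPlus M a)).stressEnergy ψ
            ⟨E4.ofTimeSpace τ y, hmem⟩ (timeVector M a (E4.ofTimeSpace τ y))
            (timeVector M a (E4.ofTimeSpace τ y))) := by
          rw [ENNReal.ofReal_mul (by norm_num), ENNReal.ofReal_ofNat]
  · rw [Set.indicator_of_notMem (show y ∉ {y : E3 | E4.ofTimeSpace τ y ∈ region a (rPlus M a)}
      from hmem)]
    exact zero_le

/-- Pointwise comparison of the integrands on a Kerr–Schild slice of the subextremal exterior: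
the height-`0` flux density is at most `15×` the cut-off coordinate energy density. [folklore] -/
theorem leafFluxDensity_le_indicator_coordEnergyDensity {M a : ℝ} (hMa : IsSubextremal M a)
    (ψ : region a (rPlus M a) → ℝ) (τ : ℝ) (y : E3) :
    leafFluxDensity M a 0 ψ τ y ≤
      15 * Set.indicator {y : E3 | E4.ofTimeSpace τ y ∈ region a (rPlus M a)}
        (fun y ↦ ENNReal.ofReal (coordEnergyDensity (region a (rPlus M a)) ψ (E4.ofTimeSpace τ y))) y := by
  by_cases hmem : E4.ofTimeSpace τ y ∈ region a (rPlus M a)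
  · rw [Set.indicator_of_mem (show y ∈ {y : E3 | E4.ofTimeSpace τ y ∈ region a (rPlus M a)}
      from hmem), leafFluxDensity_zero_height_of_mem ψ τ hmem]
    have h2 := (coordEnergyDensity_comparison_of_isSubextremal hMa ψ ⟨E4.ofTimeSpace τ y, hmem⟩).2
    calc ENNReal.ofReal ((smoothMetric M a (rPlus M a)).stressEnergy ψ
            ⟨E4.ofTimeSpace τ y, hmem⟩ (timeVector M a (E4.ofTimeSpace τ y))
            (timeVector M a (E4.ofTimeSpace τ y)))
        ≤ ENNReal.ofReal (15 * coordEnergyDensity (region a (rPlus M a)) ψ (E4.ofTimeSpace τ y)) :=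
          ENNReal.ofReal_le_ofReal h2
      _ = 15 * ENNReal.ofReal (coordEnergyDensity (region a (rPlus M a)) ψ (E4.ofTimeSpace τ y)) := by
          rw [ENNReal.ofReal_mul (by norm_num), ENNReal.ofReal_ofNat]
  · rw [leafFluxDensity_zero_height_of_not_mem ψ τ hmem]
    exact zero_le

/-- **The coordinate energy through a Kerr–Schild slice is at most `4×` the `V`-flux through it**
(`M ≥ 0`): `sliceEnergy ψ τ ≤ 4 · leafFlux 0 ψ τ`. Integrated form of the coercivity; DRSR,
arXiv:1402.7034, §3.1 (display following (23)) for `Σ_τ = {t* = τ}` and `N = V`.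
[cite: DafermosRodnianskiShlapentokhrothman2014, §3.1 display following (23)] -/
theorem sliceEnergy_le_four_mul_leafFlux {M a : ℝ} (hM : 0 ≤ M) (ψ : region a (rPlus M a) → ℝ)
    (τ : ℝ) : sliceEnergy (region a (rPlus M a)) ψ τ ≤ 4 * leafFlux M a 0 ψ τ := by
  rw [sliceEnergy, leafFlux, ← lintegral_const_mul' _ _ ENNReal.ofNat_ne_top]
  exact lintegral_mono fun y ↦ indicator_coordEnergyDensity_le_four_mul_leafFluxDensity hM ψ τ y

/-- **On the subextremal exterior the `V`-flux through a Kerr–Schild slice is at most `15×` the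
coordinate energy**: `leafFlux 0 ψ τ ≤ 15 · sliceEnergy ψ τ`. With
`sliceEnergy_le_four_mul_leafFlux` this is the two-sided comparability
`∫_{Σ_τ} J^N_μ n^μ ∼ ∫ ∑_μ (∂_μψ)²` of DRSR, arXiv:1402.7034, §3.1 (display following (23)), for the
Kerr–Schild foliation and `N = V`, with absolute constants.
[cite: DafermosRodnianskiShlapentokhrothman2014, §3.1 display following (23)] -/
theorem leafFlux_zero_height_le_sliceEnergy {M a : ℝ} (hMa : IsSubextremal M a)
    (ψ : region a (rPlus M a) → ℝ) (τ : ℝ) :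
    leafFlux M a 0 ψ τ ≤ 15 * sliceEnergy (region a (rPlus M a)) ψ τ := by
  rw [sliceEnergy, leafFlux, ← lintegral_const_mul' _ _ (ENNReal.ofNat_ne_top (n := 15))]
  exact lintegral_mono fun y ↦ leafFluxDensity_le_indicator_coordEnergyDensity hMa ψ τ y

/-- Local form (`M ≥ 0`): `localSliceEnergy ψ τ R ≤ 4 · localLeafFlux 0 ψ τ R`. DRSR,
arXiv:1402.7034, §3.1 (display following (23)), §3.3.
[cite: DafermosRodnianskiShlapentokhrothman2014, §3.1 display following (23)] -/
theorem localSliceEnergy_le_four_mul_localLeafFlux_zero_height {M a : ℝ} (hM : 0 ≤ M)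
    (ψ : region a (rPlus M a) → ℝ) (τ R : ℝ) :
    localSliceEnergy (region a (rPlus M a)) ψ τ R ≤ 4 * localLeafFlux M a 0 ψ τ R := by
  rw [localSliceEnergy, localLeafFlux, ← lintegral_const_mul' _ _ ENNReal.ofNat_ne_top]
  exact lintegral_mono fun y ↦ indicator_coordEnergyDensity_le_four_mul_leafFluxDensity hM ψ τ y

/-- Local form on the subextremal exterior: `localLeafFlux 0 ψ τ R ≤ 15 · localSliceEnergy ψ τ R`.
DRSR, arXiv:1402.7034, §3.1 (display following (23)), §3.3.
[cite: DafermosRodnianskiShlapentokhrothman2014, §3.1 display following (23)] -/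
theorem localLeafFlux_zero_height_le_localSliceEnergy {M a : ℝ} (hMa : IsSubextremal M a)
    (ψ : region a (rPlus M a) → ℝ) (τ R : ℝ) :
    localLeafFlux M a 0 ψ τ R ≤ 15 * localSliceEnergy (region a (rPlus M a)) ψ τ R := by
  rw [localSliceEnergy, localLeafFlux, ← lintegral_const_mul' _ _ (ENNReal.ofNat_ne_top (n := 15))]
  exact lintegral_mono fun y ↦ leafFluxDensity_le_indicator_coordEnergyDensity hMa ψ τ y

/-! ### Integrated comparisons: cut-off graph leaves over `{‖y‖ ≤ R}`, `R < R₁` -/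

/-- **Local comparison for the cut-off graph leaves of `KerrHyperboloidalFlux.lean`** (`M ≥ 0`,
`0 ≤ R₁`, `R < R₁`, any far slope `σ`, `h = cutoffHeight σ a R₁`): on `{‖y‖ ≤ R}` the leaf
`Σ̃_τ(h)` is the Kerr–Schild slice with normal `V` (`Kerr.leafFluxDensity_cutoffHeight_of_norm_le`),
so `localSliceEnergy ψ τ R ≤ 4 · localLeafFlux h ψ τ R ≤ 4 · leafFlux h ψ τ` — the step used inside
`Literature.Geometry.Lorentzian.drsr_wave_polynomial_decay_kerr_of_leafFlux_decay`, recorded as a statement. DRSR,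
arXiv:1402.7034, §3.3 (Cor. 3.1) and p. 51. [cite: DafermosRodnianskiShlapentokhrothman2014, §3.3 Cor. 3.1] -/
theorem localSliceEnergy_le_four_mul_localLeafFlux_cutoffHeight {σ : ℝ → ℝ} {M a R R₁ : ℝ}
    (hM : 0 ≤ M) (hR₁ : 0 ≤ R₁) (hR : R < R₁) (ψ : region a (rPlus M a) → ℝ) (τ : ℝ) :
    localSliceEnergy (region a (rPlus M a)) ψ τ R ≤
      4 * localLeafFlux M a (cutoffHeight σ a R₁) ψ τ R := by
  rw [localSliceEnergy, localLeafFlux, ← lintegral_const_mul' _ _ ENNReal.ofNat_ne_top]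
  refine setLIntegral_mono' Metric.isClosed_closedBall.measurableSet fun y hy ↦ ?_
  rw [Metric.mem_closedBall, dist_zero_right] at hy
  by_cases hmem : E4.ofTimeSpace τ y ∈ region a (rPlus M a)
  · rw [Set.indicator_of_mem (show y ∈ {y : E3 | E4.ofTimeSpace τ y ∈ region a (rPlus M a)}
      from hmem), leafFluxDensity_cutoffHeight_of_norm_le hR₁ hR ψ τ hy hmem]
    have h2 := coordEnergyDensity_le_four_mul_stressEnergy hM ψ ⟨E4.ofTimeSpace τ y, hmem⟩
    calc ENNReal.ofReal (coordEnergyDensity (region a (rPlus M a)) ψ (E4.ofTimeSpace τ y))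
        ≤ ENNReal.ofReal (4 * (smoothMetric M a (rPlus M a)).stressEnergy ψ
            ⟨E4.ofTimeSpace τ y, hmem⟩ (timeVector M a (E4.ofTimeSpace τ y))
            (timeVector M a (E4.ofTimeSpace τ y))) := ENNReal.ofReal_le_ofReal h2
      _ = 4 * ENNReal.ofReal ((smoothMetric M a (rPlus M a)).stressEnergy ψ
            ⟨E4.ofTimeSpace τ y, hmem⟩ (timeVector M a (E4.ofTimeSpace τ y))
            (timeVector M a (E4.ofTimeSpace τ y))) := by
          rw [ENNReal.ofReal_mul (by norm_num), ENNReal.ofReal_ofNat]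
  · rw [Set.indicator_of_notMem (show y ∉ {y : E3 | E4.ofTimeSpace τ y ∈ region a (rPlus M a)}
      from hmem)]
    exact zero_le

/-- **Converse local comparison for the cut-off graph leaves** on the subextremal exterior
(`0 ≤ R₁`, `R < R₁`, any far slope `σ`, `h = cutoffHeight σ a R₁`):
`localLeafFlux h ψ τ R ≤ 15 · localSliceEnergy ψ τ R` — the local flux `∫_{Σ̃_τ ∩ {‖y‖ ≤ R}} J^V_μ n^μ`
of DRSR's Cor. 3.1 (second estimate) is controlled by the local coordinate energy of
`WeightedNorms.lean`. DRSR, arXiv:1402.7034, §3.3 (Cor. 3.1), §3.1 (display following (23)).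
[cite: DafermosRodnianskiShlapentokhrothman2014, §3.3 Cor. 3.1] -/
theorem localLeafFlux_cutoffHeight_le_localSliceEnergy {σ : ℝ → ℝ} {M a R R₁ : ℝ}
    (hMa : IsSubextremal M a) (hR₁ : 0 ≤ R₁) (hR : R < R₁) (ψ : region a (rPlus M a) → ℝ)
    (τ : ℝ) :
    localLeafFlux M a (cutoffHeight σ a R₁) ψ τ R ≤
      15 * localSliceEnergy (region a (rPlus M a)) ψ τ R := by
  rw [localSliceEnergy, localLeafFlux, ← lintegral_const_mul' _ _ (ENNReal.ofNat_ne_top (n := 15))]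
  refine setLIntegral_mono' Metric.isClosed_closedBall.measurableSet fun y hy ↦ ?_
  rw [Metric.mem_closedBall, dist_zero_right] at hy
  by_cases hmem : E4.ofTimeSpace τ y ∈ region a (rPlus M a)
  · rw [Set.indicator_of_mem (show y ∈ {y : E3 | E4.ofTimeSpace τ y ∈ region a (rPlus M a)}
      from hmem), leafFluxDensity_cutoffHeight_of_norm_le hR₁ hR ψ τ hy hmem]
    have h2 := (coordEnergyDensity_comparison_of_isSubextremal hMa ψ ⟨E4.ofTimeSpace τ y, hmem⟩).2
    calc ENNReal.ofReal ((smoothMetric M a (rPlus M a)).stressEnergy ψ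
            ⟨E4.ofTimeSpace τ y, hmem⟩ (timeVector M a (E4.ofTimeSpace τ y))
            (timeVector M a (E4.ofTimeSpace τ y)))
        ≤ ENNReal.ofReal (15 * coordEnergyDensity (region a (rPlus M a)) ψ (E4.ofTimeSpace τ y)) :=
          ENNReal.ofReal_le_ofReal h2
      _ = 15 * ENNReal.ofReal (coordEnergyDensity (region a (rPlus M a)) ψ (E4.ofTimeSpace τ y)) := by
          rw [ENNReal.ofReal_mul (by norm_num), ENNReal.ofReal_ofNat]
  · -- off the exterior both densities vanish (the leaf point over `y` is `(τ, y)` since `h = 0` there)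
    have hlt : radius a (E4.ofTimeSpace 0 y) < R₁ :=
      ((radius_ofTimeSpace_le_norm a 0 y).trans hy).trans_lt hR
    have h0 : cutoffHeight σ a R₁ y = 0 := cutoffHeight_eq_zero_of_radius_le hR₁ hlt.le
    have hpt : leafPoint (cutoffHeight σ a R₁) τ y = E4.ofTimeSpace τ y := leafPoint_of_eq_zero h0 τ
    rw [leafFluxDensity_of_not_mem _ _ _ (hpt ▸ hmem)]
    exact zero_le

/-- Local comparison for the first version's hyperboloidal leaves `Σ̃_τ(h_{R₁})` (reaching `i⁰`):
`localSliceEnergy ψ τ R ≤ 4 · localLeafFlux h_{R₁} ψ τ R` (`M ≥ 0`, `0 ≤ R₁`, `R < R₁`). DRSR,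
arXiv:1402.7034, §3.3 (Cor. 3.1) and p. 51. [cite: DafermosRodnianskiShlapentokhrothman2014, §3.3 Cor. 3.1] -/
theorem localSliceEnergy_le_four_mul_localLeafFlux_hypHeight {M a R R₁ : ℝ} (hM : 0 ≤ M)
    (hR₁ : 0 ≤ R₁) (hR : R < R₁) (ψ : region a (rPlus M a) → ℝ) (τ : ℝ) :
    localSliceEnergy (region a (rPlus M a)) ψ τ R ≤
      4 * localLeafFlux M a (hypHeight M a R₁) ψ τ R :=
  localSliceEnergy_le_four_mul_localLeafFlux_cutoffHeight hM hR₁ hR ψ τ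

/-- Converse local comparison for the leaves `Σ̃_τ(h_{R₁})` on the subextremal exterior:
`localLeafFlux h_{R₁} ψ τ R ≤ 15 · localSliceEnergy ψ τ R` (`0 ≤ R₁`, `R < R₁`). DRSR,
arXiv:1402.7034, §3.3 (Cor. 3.1), §3.1. [cite: DafermosRodnianskiShlapentokhrothman2014, §3.3 Cor. 3.1] -/
theorem localLeafFlux_hypHeight_le_localSliceEnergy {M a R R₁ : ℝ} (hMa : IsSubextremal M a)
    (hR₁ : 0 ≤ R₁) (hR : R < R₁) (ψ : region a (rPlus M a) → ℝ) (τ : ℝ) :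
    localLeafFlux M a (hypHeight M a R₁) ψ τ R ≤
      15 * localSliceEnergy (region a (rPlus M a)) ψ τ R :=
  localLeafFlux_cutoffHeight_le_localSliceEnergy hMa hR₁ hR ψ τ

/-- Local comparison for the hyperboloidal leaves `Σ̃_τ(h♯_{R₁})` terminating at `𝓘⁺` (the
foliation of `Kerr.drsr_corollary_3_1_scri_flux_decay`):
`localSliceEnergy ψ τ R ≤ 4 · localLeafFlux h♯_{R₁} ψ τ R` (`M ≥ 0`, `0 ≤ R₁`, `R < R₁`). DRSR,
arXiv:1402.7034, §3.3 (Cor. 3.1) and p. 51. [cite: DafermosRodnianskiShlapentokhrothman2014, §3.3 Cor. 3.1] -/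
theorem localSliceEnergy_le_four_mul_localLeafFlux_scriHeight {M a R R₁ : ℝ} (hM : 0 ≤ M)
    (hR₁ : 0 ≤ R₁) (hR : R < R₁) (ψ : region a (rPlus M a) → ℝ) (τ : ℝ) :
    localSliceEnergy (region a (rPlus M a)) ψ τ R ≤
      4 * localLeafFlux M a (scriHeight M a R₁) ψ τ R :=
  localSliceEnergy_le_four_mul_localLeafFlux_cutoffHeight hM hR₁ hR ψ τ

/-- Converse local comparison for the leaves `Σ̃_τ(h♯_{R₁})` terminating at `𝓘⁺` on the
subextremal exterior: `localLeafFlux h♯_{R₁} ψ τ R ≤ 15 · localSliceEnergy ψ τ R` (`0 ≤ R₁`,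
`R < R₁`) — the second estimate of DRSR's Cor. 3.1, `∫_{Σ̃_τ ∩ {r ≤ R}} J^N_μ[Nψ] n^μ ≤ C E τ^{−4+2δ}`,
concerns exactly such local fluxes. DRSR, arXiv:1402.7034, §3.3 (Cor. 3.1), §3.1.
[cite: DafermosRodnianskiShlapentokhrothman2014, §3.3 Cor. 3.1] -/
theorem localLeafFlux_scriHeight_le_localSliceEnergy {M a R R₁ : ℝ} (hMa : IsSubextremal M a)
    (hR₁ : 0 ≤ R₁) (hR : R < R₁) (ψ : region a (rPlus M a) → ℝ) (τ : ℝ) :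
    localLeafFlux M a (scriHeight M a R₁) ψ τ R ≤
      15 * localSliceEnergy (region a (rPlus M a)) ψ τ R :=
  localLeafFlux_cutoffHeight_le_localSliceEnergy hMa hR₁ hR ψ τ

end Kerr

end Literature.Geometry.Lorentzian
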